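import Mathlib

/-!
# `NecksCertify` (crux stmt-FinalStateConjecture-13549, route StarvedNecks) — negative side, toolkit:
# the Pöschl–Teller zero-energy resonance `tanh` and the Bargmann norm `2 log 2` of its well

Refuter seat `refuter-cdisprove-stmt-FinalStateConjecture-13549-g2-0` (cdisprove, generation 2),
2026-08-16; workfile `Cruxes/NecksCertify/Disproof.lean` (§T "Targets").  Sorry-free, axioms
`propext`, `Classical.choice`, `Quot.sound`; `import Mathlib` only.  Companion file
`NoParkingDecaySharp.lean` uses this toolkit to show that the Bargmann threshold `η < 1` of the
picked line's model rung M2 (`NoParkingDecay`, `Cruxes/NecksCertify/Lines/bargmann-small-late-exterior.lean`)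
cannot be relaxed to `η ≤ 2 log 2`.

Contents (namespace `…Theorems.NecksCertify.Negative.PoschlTeller`):
* §1 the profile `th = sinh / cosh` (Mathlib has no `tanh` calculus): `th' = th₁ = 1/cosh²`,
  `th'' = th₂ = −2 sinh/cosh³ = (−2/cosh²)·th` (the zero-energy equation of the Pöschl–Teller well
  `V = −2 sech²`), oddness, `|th| ≤ 1`, `th → 1`, `th 2 > 1/2`, smoothness;
* §2 the Bargmann norm of the well: `∫₀^∞ s · 2 sech² s ds = 2 log 2`, via the primitive
  `bargmannPrimitive = 2 (s th s − log cosh s) → 2 log 2`;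
* §3 the slices of the free field `χ(t,r) = (th (r+t) + th (r−t))/2`: `∂ₜ²χ = ∂ᵣ²χ` in the
  `iteratedDeriv`-of-slices form of the route statements, slab data, and the rate-free decay of
  `χ` in the late retarded region `{t − r ≥ u₀}`.
-/

noncomputable section

open Real Set Filter MeasureTheory Topology

namespace Summit.FinalStateConjecture.FinalStateConjecture.Theorems.NecksCertify.Negative.PoschlTeller

/-! ## §1 The resonance profile `th = sinh / cosh` (Mathlib has no `tanh` calculus) -/

/-- The zero-energy resonance profile `th x = sinh x / cosh x` (`= tanh x`). [folklore] -/
def th (x : ℝ) : ℝ := Real.sinh x / Real.cosh x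

/-- First derivative of `th`: `th₁ x = 1 / cosh² x`. [folklore] -/
def th₁ (x : ℝ) : ℝ := 1 / Real.cosh x ^ 2

/-- Second derivative of `th`: `th₂ x = −2 sinh x / cosh³ x`. [folklore] -/
def th₂ (x : ℝ) : ℝ := -2 * Real.sinh x / Real.cosh x ^ 3

/-- `th' = th₁` (quotient rule and `cosh² − sinh² = 1`). [folklore] -/
theorem hasDerivAt_th (x : ℝ) : HasDerivAt th (th₁ x) x := by
  have hc : Real.cosh x ≠ 0 := (Real.cosh_pos x).ne'
  have h := (Real.hasDerivAt_sinh x).div (Real.hasDerivAt_cosh x) hc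
  refine h.congr_deriv ?_
  unfold th₁
  have := Real.cosh_sq_sub_sinh_sq x
  congr 1
  nlinarith [this]

/-- `(cosh²)' = 2 cosh sinh`. [folklore] -/
theorem hasDerivAt_cosh_sq (x : ℝ) :
    HasDerivAt (fun y ↦ Real.cosh y ^ 2) (2 * Real.cosh x * Real.sinh x) x := by
  refine ((Real.hasDerivAt_cosh x).pow 2).congr_deriv ?_
  push_cast
  ring

/-- `th₁' = th₂`. [folklore] -/
theorem hasDerivAt_th₁ (x : ℝ) : HasDerivAt th₁ (th₂ x) x := by
  have hc : Real.cosh x ≠ 0 := (Real.cosh_pos x).ne'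
  have h := (hasDerivAt_const x (1 : ℝ)).div (hasDerivAt_cosh_sq x) (pow_ne_zero 2 hc)
  refine h.congr_deriv ?_
  unfold th₂
  field_simp
  ring

/-- `deriv th = th₁`. [folklore] -/
theorem deriv_th : deriv th = th₁ := funext fun x ↦ (hasDerivAt_th x).deriv

/-- `deriv th₁ = th₂`. [folklore] -/
theorem deriv_th₁ : deriv th₁ = th₂ := funext fun x ↦ (hasDerivAt_th₁ x).deriv

/-- `th'' = th₂` as an `iteratedDeriv`. [folklore] -/
theorem iteratedDeriv_two_th (x : ℝ) : iteratedDeriv 2 th x = th₂ x := by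
  rw [iteratedDeriv_succ, iteratedDeriv_one, deriv_th, deriv_th₁]

/-- `th` is odd. [folklore] -/
theorem th_neg (x : ℝ) : th (-x) = -th x := by
  simp [th, Real.sinh_neg, Real.cosh_neg, neg_div]

/-- `th 0 = 0` (the Dirichlet condition on the cylinder). [folklore] -/
theorem th_zero : th 0 = 0 := by simp [th]

/-- `th < 1`. [folklore] -/
theorem th_lt_one (x : ℝ) : th x < 1 := by
  unfold th
  rw [div_lt_one (Real.cosh_pos x)]
  have h1 := Real.cosh_sq_sub_sinh_sq x
  have h2 := Real.cosh_pos x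
  nlinarith [sq_abs (Real.sinh x), abs_nonneg (Real.sinh x)]

/-- `−1 < th`. [folklore] -/
theorem neg_one_lt_th (x : ℝ) : -1 < th x := by
  have := th_lt_one (-x)
  rw [th_neg] at this
  linarith

/-- `|th| ≤ 1` (the a-priori bound `P = 1`). [folklore] -/
theorem abs_th_le_one (x : ℝ) : |th x| ≤ 1 :=
  abs_le.2 ⟨(neg_one_lt_th x).le, (th_lt_one x).le⟩

/-- The zero-energy equation of the resonance: `th'' = V · th` with the Pöschl–Teller well
`V = −2 / cosh²`. [folklore] -/
theorem th₂_eq (x : ℝ) : th₂ x = (-2 / Real.cosh x ^ 2) * th x := by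
  unfold th₂ th
  have hc : Real.cosh x ≠ 0 := (Real.cosh_pos x).ne'
  field_simp

/-- `th` is smooth. [folklore] -/
theorem contDiff_th {n : ℕ∞} : ContDiff ℝ n th := by
  unfold th
  exact Real.contDiff_sinh.div Real.contDiff_cosh fun x ↦ (Real.cosh_pos x).ne'

/-- `1 − th u = 2 / (e^{2u} + 1)`. [folklore] -/
theorem one_sub_th (u : ℝ) : 1 - th u = 2 / (Real.exp (2 * u) + 1) := by
  unfold th
  rw [Real.sinh_eq, Real.cosh_eq]
  have h1 : Real.exp u ≠ 0 := (Real.exp_pos u).ne'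
  have h2 : Real.exp (2 * u) = Real.exp u * Real.exp u := by rw [two_mul, Real.exp_add]
  have h3 : Real.exp (-u) = (Real.exp u)⁻¹ := Real.exp_neg u
  rw [h2, h3]
  field_simp
  ring

/-- `th u → 1` as `u → ∞`. [folklore] -/
theorem tendsto_th_atTop : Tendsto th atTop (𝓝 1) := by
  have h : Tendsto (fun u ↦ 1 - 2 / (Real.exp (2 * u) + 1)) atTop (𝓝 (1 - 0)) := by
    refine tendsto_const_nhds.sub ?_
    refine Tendsto.div_atTop tendsto_const_nhds ?_
    refine Filter.tendsto_atTop_add_const_right _ _ ?_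
    exact Real.tendsto_exp_atTop.comp (tendsto_id.const_mul_atTop (by norm_num : (0:ℝ) < 2))
  rw [sub_zero] at h
  refine h.congr fun u ↦ ?_
  have := one_sub_th u
  linarith

/-- `th 2 > 1/2` (the resonance does not decay: `e⁴ > 5`). [folklore] -/
theorem one_half_lt_th_two : 1 / 2 < th 2 := by
  have h := one_sub_th 2
  have he : (4 : ℝ) + 1 < Real.exp 4 := by
    have := Real.add_one_lt_exp (by norm_num : (4 : ℝ) ≠ 0)
    linarith
  have h4 : Real.exp (2 * 2) = Real.exp 4 := by norm_num
  rw [h4] at h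
  have hpos : 0 < Real.exp 4 + 1 := by positivity
  have : 2 / (Real.exp 4 + 1) < 1 / 2 := by
    rw [div_lt_div_iff₀ hpos (by norm_num : (0:ℝ) < 2)]
    linarith
  linarith


/-! ## §2 The Bargmann norm of the Pöschl–Teller well: `∫₀^∞ s · 2 sech² s ds = 2 log 2` -/

/-- The radial majorant `ν = 2 / cosh²` (`= |V|` for the Pöschl–Teller well). [folklore] -/
def ptMajorant (s : ℝ) : ℝ := 2 / Real.cosh s ^ 2

/-- `ν` is continuous. [folklore] -/
theorem continuous_ptMajorant : Continuous ptMajorant := by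
  unfold ptMajorant
  exact continuous_const.div (Real.continuous_cosh.pow 2) fun s ↦ pow_ne_zero 2 (Real.cosh_pos s).ne'

/-- Primitive of the Bargmann integrand `s ν(s)`: `bargmannPrimitive s = 2 (s th s − log cosh s)`. [folklore] -/
def bargmannPrimitive (s : ℝ) : ℝ := 2 * (s * th s - Real.log (Real.cosh s))

/-- `bargmannPrimitive' = s ν(s)`. [folklore] -/
theorem hasDerivAt_bargmannPrimitive (s : ℝ) : HasDerivAt bargmannPrimitive (s * ptMajorant s) s := by
  have hc : Real.cosh s ≠ 0 := (Real.cosh_pos s).ne'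
  have h1 : HasDerivAt (fun x ↦ x * th x) (1 * th s + s * th₁ s) s :=
    (hasDerivAt_id s).mul (hasDerivAt_th s)
  have h2 : HasDerivAt (fun x ↦ Real.log (Real.cosh x)) (Real.sinh s / Real.cosh s) s :=
    (Real.hasDerivAt_cosh s).log hc
  have h3 := (h1.sub h2).const_mul 2
  refine h3.congr_deriv ?_
  unfold th th₁ ptMajorant
  field_simp
  ring

/-- `bargmannPrimitive 0 = 0`. [folklore] -/
theorem bargmannPrimitive_zero : bargmannPrimitive 0 = 0 := by simp [bargmannPrimitive]

/-- `log cosh s = s + log (1 + e^{−2s}) − log 2`. [folklore] -/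
theorem log_cosh_eq (s : ℝ) :
    Real.log (Real.cosh s) = s + Real.log (1 + Real.exp (-2 * s)) - Real.log 2 := by
  have h : Real.cosh s = Real.exp s * (1 + Real.exp (-2 * s)) / 2 := by
    rw [Real.cosh_eq]
    have : Real.exp (-s) = Real.exp s * Real.exp (-2 * s) := by
      rw [← Real.exp_add]; ring_nf
    rw [this]; ring
  have hpos : 0 < 1 + Real.exp (-2 * s) := by positivity
  rw [h, Real.log_div (by positivity) (by norm_num), Real.log_mul (Real.exp_pos s).ne' hpos.ne',
    Real.log_exp]

/-- Closed form of the primitive: `bargmannPrimitive s = 2 (log 2 − 2s/(e^{2s}+1) − log(1 + e^{−2s}))`. [folklore] -/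
theorem bargmannPrimitive_eq (s : ℝ) :
    bargmannPrimitive s = 2 * (Real.log 2 - 2 * s / (Real.exp (2 * s) + 1) - Real.log (1 + Real.exp (-2 * s))) := by
  unfold bargmannPrimitive
  have h1 : th s = 1 - 2 / (Real.exp (2 * s) + 1) := by have := one_sub_th s; linarith
  rw [h1, log_cosh_eq]
  ring

/-- `bargmannPrimitive s → 2 log 2` as `s → ∞` (the Bargmann norm of the well). [folklore] -/
theorem tendsto_bargmannPrimitive_atTop : Tendsto bargmannPrimitive atTop (𝓝 (2 * Real.log 2)) := by
  have hA : Tendsto (fun s : ℝ ↦ 2 * s / (Real.exp (2 * s) + 1)) atTop (𝓝 0) := by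
    have h0 : Tendsto (fun s : ℝ ↦ (2 * s) ^ (1 : ℕ) * Real.exp (-(2 * s))) atTop (𝓝 0) :=
      (Real.tendsto_pow_mul_exp_neg_atTop_nhds_zero 1).comp
        (tendsto_id.const_mul_atTop (by norm_num : (0:ℝ) < 2))
    refine tendsto_of_tendsto_of_tendsto_of_le_of_le' tendsto_const_nhds h0 ?_ ?_
    · filter_upwards [eventually_ge_atTop 0] with s hs
      positivity
    · filter_upwards [eventually_ge_atTop 0] with s hs
      rw [pow_one, Real.exp_neg, ← div_eq_mul_inv]
      exact div_le_div_of_nonneg_left (by positivity) (Real.exp_pos _)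
        (by linarith [Real.exp_pos (2 * s)])
  have hB : Tendsto (fun s : ℝ ↦ Real.log (1 + Real.exp (-2 * s))) atTop (𝓝 0) := by
    have h1 : Tendsto (fun s : ℝ ↦ 1 + Real.exp (-2 * s)) atTop (𝓝 (1 + 0)) := by
      refine tendsto_const_nhds.add ?_
      refine Real.tendsto_exp_atBot.comp ?_
      exact tendsto_id.const_mul_atTop_of_neg (by norm_num : (-2:ℝ) < 0)
    have h2 := (Real.continuousAt_log (by norm_num : (1:ℝ) + 0 ≠ 0)).tendsto.comp h1
    simpa [Function.comp_def] using h2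
  have h := ((tendsto_const_nhds (x := Real.log 2)).sub hA).sub hB |>.const_mul 2
  simp only [sub_zero] at h
  exact h.congr fun s ↦ (bargmannPrimitive_eq s).symm

/-- The Bargmann integrand `(s − 0) ν(s)` is integrable on `(0, ∞)`. [folklore] -/
theorem integrableOn_bargmann : IntegrableOn (fun s ↦ (s - 0) * ptMajorant s) (Set.Ioi 0) := by
  simp_rw [sub_zero]
  exact integrableOn_Ioi_deriv_of_nonneg' (fun s _ ↦ hasDerivAt_bargmannPrimitive s)
    (fun s hs ↦ by unfold ptMajorant; have := hs.out.le; positivity) tendsto_bargmannPrimitive_atTop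

/-- **Bargmann norm of the Pöschl–Teller well:** `∫₀^∞ (s − 0) · 2 sech² s ds = 2 log 2`. [folklore] -/
theorem integral_bargmann : ∫ s in Set.Ioi 0, (s - 0) * ptMajorant s = 2 * Real.log 2 := by
  simp_rw [sub_zero]
  rw [integral_Ioi_of_hasDerivAt_of_nonneg' (fun s _ ↦ hasDerivAt_bargmannPrimitive s)
    (fun s hs ↦ by unfold ptMajorant; have := hs.out.le; positivity) tendsto_bargmannPrimitive_atTop, bargmannPrimitive_zero, sub_zero]

/-! ## §3 The witness fields: `ψ = th r`, `χ = (th (r+t) + th (r−t))/2`, `V = −2/cosh² r` -/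

/-- `t`-slice of the free field: first derivative. [folklore] -/
theorem hasDerivAt_chi_t (r t : ℝ) :
    HasDerivAt (fun s ↦ (th (r + s) + th (r - s)) / 2) ((th₁ (r + t) - th₁ (r - t)) / 2) t := by
  have h1 : HasDerivAt (fun s ↦ th (r + s)) (th₁ (r + t)) t := (hasDerivAt_th (r + t)).comp_const_add r t
  have h2 : HasDerivAt (fun s ↦ th (r - s)) (-th₁ (r - t)) t := (hasDerivAt_th (r - t)).comp_const_sub r t
  refine ((h1.add h2).div_const 2).congr_deriv ?_
  ring

/-- `t`-slice of the free field: derivative of the first derivative. [folklore] -/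
theorem hasDerivAt_chi_t' (r t : ℝ) :
    HasDerivAt (fun s ↦ (th₁ (r + s) - th₁ (r - s)) / 2) ((th₂ (r + t) + th₂ (r - t)) / 2) t := by
  have h1 : HasDerivAt (fun s ↦ th₁ (r + s)) (th₂ (r + t)) t :=
    (hasDerivAt_th₁ (r + t)).comp_const_add r t
  have h2 : HasDerivAt (fun s ↦ th₁ (r - s)) (-th₂ (r - t)) t :=
    (hasDerivAt_th₁ (r - t)).comp_const_sub r t
  refine ((h1.sub h2).div_const 2).congr_deriv ?_
  ring

/-- `∂ₜ²χ = (th'' (r+t) + th'' (r−t))/2`. [folklore] -/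
theorem iteratedDeriv_two_chi_t (r t : ℝ) :
    iteratedDeriv 2 (fun s ↦ (th (r + s) + th (r - s)) / 2) t = (th₂ (r + t) + th₂ (r - t)) / 2 := by
  rw [iteratedDeriv_succ, iteratedDeriv_one]
  have hd : deriv (fun s ↦ (th (r + s) + th (r - s)) / 2) = fun s ↦ (th₁ (r + s) - th₁ (r - s)) / 2 :=
    funext fun s ↦ (hasDerivAt_chi_t r s).deriv
  rw [hd]
  exact (hasDerivAt_chi_t' r t).deriv

/-- `r`-slice of the free field: first derivative. [folklore] -/
theorem hasDerivAt_chi_r (t r : ℝ) :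
    HasDerivAt (fun x ↦ (th (x + t) + th (x - t)) / 2) ((th₁ (r + t) + th₁ (r - t)) / 2) r := by
  have h1 : HasDerivAt (fun x ↦ th (x + t)) (th₁ (r + t)) r := (hasDerivAt_th (r + t)).comp_add_const r t
  have h2 : HasDerivAt (fun x ↦ th (x - t)) (th₁ (r - t)) r := (hasDerivAt_th (r - t)).comp_sub_const r t
  exact (h1.add h2).div_const 2

/-- `r`-slice of the free field: derivative of the first derivative. [folklore] -/
theorem hasDerivAt_chi_r' (t r : ℝ) :
    HasDerivAt (fun x ↦ (th₁ (x + t) + th₁ (x - t)) / 2) ((th₂ (r + t) + th₂ (r - t)) / 2) r := by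
  have h1 : HasDerivAt (fun x ↦ th₁ (x + t)) (th₂ (r + t)) r :=
    (hasDerivAt_th₁ (r + t)).comp_add_const r t
  have h2 : HasDerivAt (fun x ↦ th₁ (x - t)) (th₂ (r - t)) r :=
    (hasDerivAt_th₁ (r - t)).comp_sub_const r t
  exact (h1.add h2).div_const 2

/-- `∂ᵣ²χ = (th'' (r+t) + th'' (r−t))/2`. [folklore] -/
theorem iteratedDeriv_two_chi_r (t r : ℝ) :
    iteratedDeriv 2 (fun x ↦ (th (x + t) + th (x - t)) / 2) r = (th₂ (r + t) + th₂ (r - t)) / 2 := by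
  rw [iteratedDeriv_succ, iteratedDeriv_one]
  have hd : deriv (fun x ↦ (th (x + t) + th (x - t)) / 2) = fun x ↦ (th₁ (x + t) + th₁ (x - t)) / 2 :=
    funext fun x ↦ (hasDerivAt_chi_r t x).deriv
  rw [hd]
  exact (hasDerivAt_chi_r' t r).deriv

/-- The free field decays in the late retarded region: for `t − r ≥ u₀ → ∞` (and `r ≥ 0`),
`χ = (th (t+r) − th (t−r))/2 → 0` uniformly. [folklore] -/
theorem chi_decay : ∀ ε > 0, ∃ u₀ : ℝ, ∀ t r : ℝ, 0 ≤ t → 0 ≤ r → u₀ ≤ t - r →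
    |(th (r + t) + th (r - t)) / 2| ≤ ε := by
  intro ε hε
  have h := (tendsto_order.1 tendsto_th_atTop).1 (1 - ε) (by linarith)
  obtain ⟨u₀, hu₀⟩ := (Filter.eventually_atTop.1 h)
  refine ⟨u₀, fun t r _ hr htr ↦ ?_⟩
  have e : th (r - t) = -th (t - r) := by rw [← th_neg]; ring_nf
  rw [e]
  have h1 : 1 - ε < th (t - r) := hu₀ _ htr
  have h2 : 1 - ε < th (r + t) := hu₀ _ (by linarith)
  have h3 := th_lt_one (t - r)
  have h4 := th_lt_one (r + t)
  rw [abs_le]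
  constructor <;> linarith

end Summit.FinalStateConjecture.FinalStateConjecture.Theorems.NecksCertify.Negative.PoschlTeller

end
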